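import Summits.CriticalPhenomena.PercolationContinuityZ3.Theorems.Transplant.GrigorchukTwoGroup
import Summits.CriticalPhenomena.PercolationContinuityZ3.Theorems.Transplant.GrigorchukLevelTransitive
import Mathlib.Data.Set.Finite.Basic
import HarnessLib

/-!
# The tree's first Grigorchuk group is an INFINITE, finitely generated 2-GROUP — a kernel-verified counterexample to the general Burnside problem

builds on p205010 (kernel theorem, internal audit signed; external expert review pending) — nothing in this file uses p205010; pure group theory, no percolation
statement, no node touched.  Group theory of `𝔊` (Grigorchuk 1980): the two facts «GrigorchukTwoGroup» p593859 (every element is killed by a power of `2`) and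
«GrigorchukLevelTransitive» p593398 (the orbit of every ray is infinite) packaged: `𝔊 = ⟨a, b, c, d⟩ ≤ Perm({0,1}^ℕ)` — finitely generated BY DEFINITION
(«GrigorchukLamplighterDefs» p581401: the closure of four explicit involutions) — is INFINITE and every element has order a power of `2`.  A finitely generated infinite
torsion group is a counterexample to the general Burnside problem (first counterexamples: Golod 1964; Grigorchuk's group, 1980, is the standard one); to our knowledge
no such group is formalised in Mathlib.  Lane `prim-bschramm`, seat `prim-bschramm-p3` gen 35 (DESIGN OWNER; `run/shared/lean/prim/bschramm/P3-NILPOTENT.md` §28.8).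
Helper file (`--supports stmt-CriticalPhenomena-4575 --as helper`).  Def-free.  NOTHING about growth (intermediate growth is Grigorchuk 1984 — not typed, not claimed),
amenability, or the end state.
* `Grigorchuk.orbit_rho_infinite`, `grigorchukGroup_infinite : (grigorchukGroup : Set (Equiv.Perm Ray)).Infinite`,
  **`grigorchukGroup_infinite_twoGroup`**: infinite ∧ every element killed by a power of `2`.
[cite: Grigorchuk1980, Theorem: the group generated by a, b, c, d is an infinite 2-group] [cite: BartholdiErschler2012, §3.1 (the first Grigorchuk group: an infinite
finitely generated torsion group)]
-/

noncomputable section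

namespace Summit.CriticalPhenomena.PercolationContinuityZ3.Theorems.Transplant

namespace Grigorchuk

/-- **The orbit `X = 𝔊ρ` of the ray `ρ = 1^∞` is infinite.** [cite: BartholdiErschler2012, §3.1 (the orbit X of ρ)] [cite: Grigorchuk1980, level-transitivity] -/
theorem orbit_rho_infinite : {x : Ray | ∃ g : Equiv.Perm Ray, g ∈ grigorchukGroup ∧ g rho = x}.Infinite := by
  obtain ⟨r, hrinj, hr⟩ := exists_orbit_seq rho rho 0
  exact Set.infinite_of_injective_forall_mem hrinj fun m => (hr m).1

/-- **`𝔊` is infinite.** [cite: Grigorchuk1980, Theorem: the group is infinite] -/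
theorem grigorchukGroup_infinite : (grigorchukGroup : Set (Equiv.Perm Ray)).Infinite := by
  obtain ⟨r, hrinj, hr⟩ := exists_orbit_seq rho rho 0
  choose g hg hgr using fun m => (hr m).1
  refine Set.infinite_of_injective_forall_mem (f := g) (fun m m' h => hrinj ?_) hg
  rw [← hgr m, ← hgr m', h]

/-- **THE FIRST GRIGORCHUK GROUP (as typed in the tree) IS AN INFINITE 2-GROUP**: `𝔊 = ⟨a, b, c, d⟩ ≤ Perm({0,1}^ℕ)` — finitely generated by definition — is infinite
and every element is killed by a power of `2`.  A finitely generated infinite torsion group: a counterexample to the general Burnside problem, kernel-verified.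
[cite: Grigorchuk1980, Theorem: the group generated by a, b, c, d is an infinite 2-group] -/
theorem grigorchukGroup_infinite_twoGroup :
    (grigorchukGroup : Set (Equiv.Perm Ray)).Infinite ∧ ∀ g ∈ grigorchukGroup, ∃ k : ℕ, g ^ 2 ^ k = 1 :=
  ⟨grigorchukGroup_infinite, fun _ hg => exists_pow_two_pow_eq_one hg⟩

/-- The same with `IsOfFinOrder`: `𝔊` is an infinite torsion group generated by four involutions. [cite: Grigorchuk1980, Theorem] -/
theorem grigorchukGroup_infinite_torsion :
    (grigorchukGroup : Set (Equiv.Perm Ray)).Infinite ∧ (∀ g ∈ grigorchukGroup, IsOfFinOrder g) ∧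
      grigorchukGroup = Subgroup.closure {genA, genB, genC, genD} :=
  ⟨grigorchukGroup_infinite, fun _ hg => isOfFinOrder_of_mem hg, rfl⟩

end Grigorchuk

end Summit.CriticalPhenomena.PercolationContinuityZ3.Theorems.Transplant

end
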